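import Mathlib
import HarnessLib
import Literature.Analysis.Matrix.GrothendieckInequality
import Summits.QuantumAdvantage.QuantumAdvantage.Theorems.SoloInformedGrothendieckFrobenius

/-!
# THEOREM DC as a one-hypothesis kernel statement: deletion numbers of cube-bounded quadratic
# forms, conditional only on the named fact `GrothendieckFactorization`

Solo seat `solo-QuantumAdvantage-informed`, session 13, file 31 (§4.27 (1) of the seat's paper).

Files 29–30 (`SoloInformedGrothendieckDeletion`, `SoloInformedGrothendieckFrobenius`) kernel-check the
problem-side halves of THEOREM DC — F4 (`‖A‖_{∞→1} ≤ 1` for a bounded quadratic) and the deletion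
from ANY factorization `|xᵀAy| ≤ K‖x‖_{L₂(w)}‖y‖_{L₂(w)}` — with the factorization as an explicit
hypothesis `hfac`. The Literature file `Literature/Analysis/Matrix/GrothendieckInequality.lean` now
carries Grothendieck's inequality in factorization form as the named fact
`Literature.Analysis.Matrix.GrothendieckFactorization` ([Pisier2011, Thm 2.1]; [Tropp2008, Thm 12];
constant = Krivine's bound `krivineBound = π/(2 log(1+√2)) < 2`) and PROVES from it the symmetric
one-weight form `grothendieckFactorization_symm`. This file composes the three:

* `cutnorm_deletion` — for every real SYMMETRIC `A` with `|sᵀAt| ≤ M` on sign vectors and every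
  `o > 0` there is `F` with `|F| ≤ K·M/o`, `|xᵀAy| ≤ o‖x‖₂‖y‖₂` for `x, y` vanishing on `F`, and
  `Σ_{i,j ∉ F} A_{ij}² ≤ K·M·o` (`K = krivineBound`) — the "more generally" clause of THEOREM DC;
* `dc_of_grothendieck` — THEOREM DC proper: for a bounded quadratic `q = c + ⟨b,x⟩ + xᵀAx ∈ [0,1]`
  on `{−1,1}ⁿ` (`A` symmetric, zero diagonal): `|F| ≤ K/o`, op-norm `≤ o` and Frobenius mass
  `≤ K·o` off `F`; `dc_of_grothendieck_two` — the same with the numerical bound `|F| ≤ 2/o`,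
  Frobenius `≤ 2·o`; `dc_of_grothendieck_Mp` — the `M_p` form (`|xᵀAy| ≤ o·p` when
  `‖x‖₂², ‖y‖₂² ≤ p`), i.e. `N′_del(A; p, t) ≤ K p/t`.

Trust base of THEOREM DC after this file: Mathlib's axioms + the single named fact
`GrothendieckFactorization` (Grothendieck 1953 / Lindenstrauss–Pełczyński 1968 / Krivine 1979).
-/

namespace Summit.QuantumAdvantage.QuantumAdvantage.Theorems

namespace BoundedQuadratic

open Finset Literature.Analysis.Matrix

variable {n : ℕ}

/-- **Cut-norm deletion (THEOREM DC, general symmetric form), conditional on Grothendieck's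
inequality.** If `A` is real symmetric with `|sᵀAt| ≤ M` for all sign vectors (`‖A‖_{∞→1} ≤ M`), then
for every `o > 0` some `F` with `|F| ≤ K·M/o` (`K = krivineBound < 2`) has
`|xᵀAy| ≤ o‖x‖₂‖y‖₂` for all `x, y` vanishing on `F` and `Σ_{i,j∉F} A_{ij}² ≤ K·M·o`. -/
theorem cutnorm_deletion (hGT : GrothendieckFactorization) (A : Matrix (Fin n) (Fin n) ℝ)
    (hA : ∀ i j, A i j = A j i) {M : ℝ} (hMpos : 0 < M)
    (hM : ∀ s t : Fin n → ℝ, (∀ i, s i = 1 ∨ s i = -1) → (∀ j, t j = 1 ∨ t j = -1) →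
      |∑ i, ∑ j, A i j * s i * t j| ≤ M)
    {o : ℝ} (ho : 0 < o) :
    ∃ F : Finset (Fin n), (F.card : ℝ) ≤ krivineBound * M / o ∧
      (∀ x y : Fin n → ℝ, (∀ i ∈ F, x i = 0) → (∀ i ∈ F, y i = 0) →
        |∑ i, ∑ j, A i j * x i * y j| ≤ o * Real.sqrt (∑ i, x i ^ 2) * Real.sqrt (∑ i, y i ^ 2)) ∧
      ∑ i, ∑ j, (if i ∈ F ∨ j ∈ F then 0 else A i j ^ 2) ≤ krivineBound * M * o := by
  obtain ⟨w, hw, hw1, hfac⟩ := grothendieckFactorization_symm hGT A hA hM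
  exact grothendieck_phase A (mul_pos krivineBound_pos hMpos) w hw hw1 hfac ho

/-- **THEOREM DC, conditional on Grothendieck's inequality.** For a bounded quadratic
`q(x) = c + ⟨b,x⟩ + xᵀAx ∈ [0,1]` on `{−1,1}ⁿ` (`A` symmetric, zero diagonal) and every `o > 0` there
is a set `F` of at most `K/o` coordinates (`K = krivineBound = π/(2 log(1+√2))`) off which the
bilinear form is bounded by `o‖x‖₂‖y‖₂` (so `‖A_{FᶜFᶜ}‖_op ≤ o`) and the Frobenius mass is `≤ K·o`.
Inputs: F4 (`sign_bilinear_abs_le_one`, file 29), `grothendieckFactorization_symm` (Literature,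
from the named fact), `grothendieck_phase` (file 30). -/
theorem dc_of_grothendieck (hGT : GrothendieckFactorization) (c : ℝ) (b : Fin n → ℝ)
    (A : Matrix (Fin n) (Fin n) ℝ) (hA : ∀ i j, A i j = A j i) (hdiag : ∀ i, A i i = 0)
    (hq : ∀ x, IsSignVec x →
      0 ≤ c + ∑ i, b i * x i + quadForm A x ∧ c + ∑ i, b i * x i + quadForm A x ≤ 1)
    {o : ℝ} (ho : 0 < o) :
    ∃ F : Finset (Fin n), (F.card : ℝ) ≤ krivineBound / o ∧
      (∀ x y : Fin n → ℝ, (∀ i ∈ F, x i = 0) → (∀ i ∈ F, y i = 0) →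
        |∑ i, ∑ j, A i j * x i * y j| ≤ o * Real.sqrt (∑ i, x i ^ 2) * Real.sqrt (∑ i, y i ^ 2)) ∧
      ∑ i, ∑ j, (if i ∈ F ∨ j ∈ F then 0 else A i j ^ 2) ≤ krivineBound * o := by
  have hM : ∀ s t : Fin n → ℝ, (∀ i, s i = 1 ∨ s i = -1) → (∀ j, t j = 1 ∨ t j = -1) →
      |∑ i, ∑ j, A i j * s i * t j| ≤ 1 :=
    fun s t hs ht => sign_bilinear_abs_le_one c b A hA hdiag hq hs ht
  obtain ⟨F, hcard, hop, hfrob⟩ := cutnorm_deletion hGT A hA one_pos hM ho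
  refine ⟨F, by simpa using hcard, hop, by simpa using hfrob⟩

/-- THEOREM DC with numerical constants: `|F| ≤ 2/o` and Frobenius mass `≤ 2·o` off `F`
(`krivineBound < 2`). -/
theorem dc_of_grothendieck_two (hGT : GrothendieckFactorization) (c : ℝ) (b : Fin n → ℝ)
    (A : Matrix (Fin n) (Fin n) ℝ) (hA : ∀ i j, A i j = A j i) (hdiag : ∀ i, A i i = 0)
    (hq : ∀ x, IsSignVec x →
      0 ≤ c + ∑ i, b i * x i + quadForm A x ∧ c + ∑ i, b i * x i + quadForm A x ≤ 1)
    {o : ℝ} (ho : 0 < o) :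
    ∃ F : Finset (Fin n), (F.card : ℝ) ≤ 2 / o ∧
      (∀ x y : Fin n → ℝ, (∀ i ∈ F, x i = 0) → (∀ i ∈ F, y i = 0) →
        |∑ i, ∑ j, A i j * x i * y j| ≤ o * Real.sqrt (∑ i, x i ^ 2) * Real.sqrt (∑ i, y i ^ 2)) ∧
      ∑ i, ∑ j, (if i ∈ F ∨ j ∈ F then 0 else A i j ^ 2) ≤ 2 * o := by
  obtain ⟨F, hcard, hop, hfrob⟩ := dc_of_grothendieck hGT c b A hA hdiag hq ho
  have hK := krivineBound_lt_two
  refine ⟨F, le_trans hcard (div_le_div_of_nonneg_right hK.le ho.le), hop,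
    le_trans hfrob (mul_le_mul_of_nonneg_right hK.le ho.le)⟩

/-- THEOREM DC in the `M_p` form of the paper's Proposition F: off the same `F` (`|F| ≤ K/o`), for
`x, y` vanishing on `F` with `‖x‖₂², ‖y‖₂² ≤ p`, `|xᵀAy| ≤ o·p`; hence `N′_del(A; p, t) ≤ K·p/t`. -/
theorem dc_of_grothendieck_Mp (hGT : GrothendieckFactorization) (c : ℝ) (b : Fin n → ℝ)
    (A : Matrix (Fin n) (Fin n) ℝ) (hA : ∀ i j, A i j = A j i) (hdiag : ∀ i, A i i = 0)
    (hq : ∀ x, IsSignVec x →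
      0 ≤ c + ∑ i, b i * x i + quadForm A x ∧ c + ∑ i, b i * x i + quadForm A x ≤ 1)
    {o : ℝ} (ho : 0 < o) {p : ℝ} (hp : 0 ≤ p) :
    ∃ F : Finset (Fin n), (F.card : ℝ) ≤ krivineBound / o ∧
      ∀ x y : Fin n → ℝ, (∀ i ∈ F, x i = 0) → (∀ i ∈ F, y i = 0) →
        ∑ i, x i ^ 2 ≤ p → ∑ i, y i ^ 2 ≤ p →
        |∑ i, ∑ j, A i j * x i * y j| ≤ o * p := by
  obtain ⟨F, hcard, hop, -⟩ := dc_of_grothendieck hGT c b A hA hdiag hq ho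
  refine ⟨F, hcard, fun x y hx hy hxp hyp => ?_⟩
  have h := hop x y hx hy
  have hsx : Real.sqrt (∑ i, x i ^ 2) ≤ Real.sqrt p := Real.sqrt_le_sqrt hxp
  have hsy : Real.sqrt (∑ i, y i ^ 2) ≤ Real.sqrt p := Real.sqrt_le_sqrt hyp
  calc |∑ i, ∑ j, A i j * x i * y j|
      ≤ o * Real.sqrt (∑ i, x i ^ 2) * Real.sqrt (∑ i, y i ^ 2) := h
    _ ≤ o * Real.sqrt p * Real.sqrt p := by
        apply mul_le_mul (mul_le_mul_of_nonneg_left hsx ho.le) hsy (Real.sqrt_nonneg _)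
        exact mul_nonneg ho.le (Real.sqrt_nonneg _)
    _ = o * p := by rw [mul_assoc, Real.mul_self_sqrt hp]

end BoundedQuadratic

end Summit.QuantumAdvantage.QuantumAdvantage.Theorems
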